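import Summits.PneNP.PneNP.Theses.KarlinRubin
import Summits.PneNP.PneNP.Theorems.MonotoneBlind.Negative.LoadBearing
import Summits.PneNP.PneNP.Theorems.MonotoneBlind.Negative.DeltaRange
import Summits.PneNP.PneNP.Theorems.MonotoneBlind.Negative.DegreeTest
import Summits.PneNP.PneNP.Theorems.KarlinRubinMonotoneBlindDelta
import Summits.PneNP.PneNP.Theorems.PlantedcliqueIndistinguishable.Negative.FalseWithoutAdmissible

/-!
# Disproof of `MonotoneBlind` — findings: NO KILL (cycle 1); the crux is the monotone, strong-detection
# shadow of the nonuniform planted-clique conjecture; every syntactic hypothesis is classified and LANDED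
# (Negative/LoadBearing, DeltaRange p160741, DegreeTestCounting p162005, DegreeTest p162233); 0 sorries

Crux (stmt-PneNP-18027, route PneNP/KarlinRubin, rank 3):
`MonotoneBlind := ∀ δ ∈ (0,1/2), ∀ c, ¬ ∃ C : (n : ℕ) → Circuit (E(Kₙ)),
  (∀ᶠ n, (C n).IsOver monotoneBasis01 ∧ (C n).size ≤ n^c) ∧ errSum δ C → 0`,
`errSum δ C n = Pr_{G(n,1/2)}[C n = 1] + Pr_{G(n,1/2) ∪ K_A, |A| = ⌈n^{1/2-δ}⌉}[C n = 0]`.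

## Index of findings (disprover seat refuter-cdisprove-stmt-PneNP-18027-0, 2026-08-17)

**Read-back (no misstatement).** `monotoneBasis01 = {∧₂, ∨₂, 0, 1}` as `GateFn`s (arity + truth
table, so function extensionality pins the gate); leaves `Sum.inl e` read edge indicators POSITIVELY
only (`Circuit.wireVals`), hence `Circuit.monotone_eval_of_isOver_monotoneBasis01`; `erdosRenyiHalf` is
uniform on `EdgeVec n`; `plantedCliqueDist n k` plants (`x e || [e ⊆ S]`) on a UNIFORM `min k n`-subset
— for `k = ⌈n^{1/2-δ}⌉ ≤ n` no `kSubsets` junk; `errSum` is exact (`PMF.toOuterMeasure`, `ℝ≥0∞`);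
quantifier order `∀ δ ∀ c ¬ ∃ C` = "no polynomial-size family" — as printed. A kill is
`not_monotoneBlind_iff` (LoadBearing §0): ONE `δ`, ONE `c`, one monotone family with `errSum → 0`,
i.e. a polynomial-size monotone strong detector below `√n` — it would refute the NONUNIFORM planted
clique conjecture (`Theorems.karlinRubin_monotoneBlind_of_noPolyB2Detector`: PolyHard(B₂) ⇒ crux).
None is known; every monotone statistic in print (edge count, degree thresholds, counts of
high-degree vertices, peeling, `t`-seed guess-and-verify) falls a factor `n^{δ}` short or costs
`n^{2δ log₂ n + O(log log n)}` gates (route header NUMBERS; census N1).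

**(a) Load-bearing analysis — every hypothesis of the crux, as theorems (§A).**
| hypothesis dropped | status | theorem |
|---|---|---|
| size bound `size ≤ n^c` | FALSE at every `δ` (brute force `CLIQUE(n,3⌊log₂n⌋+3)`, size `n^{3⌊log₂n⌋+5}`) | `monotoneBlind_false_without_sizeBound` (landed, LoadBearing §1) |
| error clause | FALSE (constant family) | `monotoneBlind_false_without_errorClause` (landed, LoadBearing §2) |
| `0 < δ` | FALSE (`δ = -1/2`: AND of all edges, size `≤ n²`; and at EVERY `δ < 0`: max-degree test, size `≤ n⁴`) | `monotoneBlind_false_without_posDelta` (LANDED p160741, Negative/DeltaRange); `monotoneBlindAt_false_of_neg` (LANDED p162005 + p162233, Negative/DegreeTestCounting + DegreeTest) |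
| `δ < 1/2` | EQUIVALENT to the crux (vacuous range `k ≤ 1`) | `monotoneBlind_iff_without_upperDelta` (LANDED p160741) |
| basis `IsOver monotoneBasis01` (dropped) | FALSE (`c = 0`: one fan-in-`C(n,2)` gate) | `monotoneBlind_false_without_basis` (LANDED p160741) |
| basis weakened to `B₂` | = nonuniform PC conjecture, believed TRUE | `karlinRubin_monotoneBlind_of_noPolyB2Detector` (landed) |
So: the size bound, the error clause, `0 < δ` and the fan-in part of the basis are load-bearing;
`δ < 1/2` is decoration; MONOTONICITY is load-bearing for provability only (dropping it makes the
statement stronger and still conjecturally true) — a proof may, but a disproof cannot, exploit it.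

**(b) Tightness / boundary (§B).** The room is polynomial vs quasi-polynomial:
`not_quasipolyBlind` (monotone size `n^{3⌊log₂ n⌋+5}` strongly detects at every `δ`; conjectured
truth `n^{Θ(δ log n)}`). In `δ`: detection is a down-set (`karlinRubin_detects_of_le`, landed);
refuted for `δ ≤ -1/2` (`monotoneBlindAt_false_of_le_neg_half`, LANDED) and — the former near-miss,
now LANDED in two parts (`Negative/DegreeTestCounting.lean` p162005, `Negative/DegreeTest.lean`
p162233; standard axioms) — for EVERY `δ < 0`:
Kučera's max-degree test `[∃ v : #{absent slots at v} ≤ ⌊(2n-k)/4⌋]` is a `{∧₂,∨₂,0,1}`-circuit of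
size `≤ n⁴` (the counting network of `ResolutionUncertainty/Negative/ShadowSeparators` on singleton
blocks, OR-ed over vertices) with error sum `≤ (n+1)·exp(-k²/(32n)) → 0` for `k = ⌈n^{1/2+|δ|}⌉`
(Hoeffding in counting form, `hoeffding_count_pi`, at each vertex / at a planted vertex).
So the crux's hypothesis `0 < δ` is SHARP up to the single boundary point `δ = 0` (`k = ⌈√n⌉`), which
is OPEN for strong monotone detection in polynomial size (counts of high-degree vertices give
constant, not vanishing, error; the AKS spectral test is not monotone). Upper end:
`no_detector_of_half_le` — at `δ ≥ 1/2` nothing is planted and `errSum ≡ 1` for every test.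

**(c) Natural strengthenings (§C).** Quasi-poly blindness: FALSE (`not_quasipolyBlind`).
Blindness on the closed range `δ ∈ [0,1/2)`: open at `δ = 0` (above). Weak-detection blindness
("errSum ≤ 1 - ε impossible"): not attackable either (edge count has advantage `Θ(n^{-2δ}) → 0`;
constant advantage below `√n` in poly size would refute the weak PC conjecture).

**(d) Targets — the registered skeleton `d734d1ea…` (line `Sketch` = vertex-cover duality,
lead prover-line-stmt-PneNP-18027-0), §D.** No stub is killed.
`stub_acceptanceSplit`: TRUE, proved here (`stub_acceptanceSplit_holds`, 6 lines) — attachable.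
`stub_plantingBound`: TRUE (Fubini over `plantedCliqueDist_…_eq_sum` + split on `B`; all `n, k, η`).
`stub_coverBound`: TRUE (union bound + fibre factor `Pr[S ⊆ A] = ∏_{i<s}(k'-i)/(n-i) ≤ (k'/n)^s`,
`k' = min k n`; degenerate `n = 0`, `k = 0`, `S = ∅` all check: `0/0 = 0`, `x^0 = 1` in `ℝ≥0∞`).
`stub_coverCertificate`: NOT cheaper than the crux — with the other three stubs it implies
`MonotoneBlind`, and it is STRICTLY STRONGER in form: it asks, for typical noise `x`, for an
`η`-cheap cover of the completion up-set `U_C(x) = {A : C(x ∪ K_A) = 1}` AT THE PLANTING DENSITY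
`p = k'/n`, whereas blindness only needs `μ_{k'}(U_C(x)) ≤ η`. Weak LP duality
(`coverCost_ge_spreadMass`, §D) shows the gap can be TOTAL: if `U_C(x)` supports a sub-probability
measure `ν` with `ν(A ⊇ S) ≤ p^{|S|}` for all `S ≠ ∅` and mass `ν(U) = m`, every cover costs `≥ m`,
whatever `μ_{k'}(U)` is. The coupon-collector up-set `{A : A meets every block B₁,…,B_ℓ}`
(`ℓ` blocks of size `b`, `pb = ln ℓ - c`, `c → ∞`) has `μ → 0` but supports such a `ν` of mass `1`
(uniform on transversals: `ν(⊇S) = b^{-|S|} ≤ p^{|S|}` iff `pb ≥ 1`) — the Kahn–Kalai/Park–Pham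
`log ℓ` window, which the stub's fixed-density formulation does not have. For the circuits that
matter this is harmless as long as `U_C(x)` is threshold-like (covers by Turán systems / covering
designs cost `poly(λ)·μ(U)`, checked on paper for edge-count and degree-count tests, §D notes), but a
quiet small monotone `C` whose completion up-sets contain a block-transversal-type spread family
would falsify the stub WITHOUT touching the crux (such a `C` accepts a spread `n^{-ω(1)}`… `n^{-O(1)}`
sub-family of planted cliques perfectly; its existence is not excluded by PC-type heuristics, since
the required power is tiny). RECOMMENDATION to the lead (not a kill): if `stub_coverCertificate`
resists, weaken it to a cover at density `p / (K log n)` (Park–Pham form) and pay `(K log n)^{|S|}`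
in `stub_coverBound`'s use — the assembly survives iff the cover elements have bounded size, which
is what the depth-2 calculus (`karlinRubin_dnf_planted_tendsto_zero`) delivers anyway.

**Why the crux resists (for provers).** It is a genuine monotone SIZE lower bound with NOISY
positives at `p = 1/2` (census B1–B3: plucking against `G(n,1/2)` is walled; dose/threshold lemmas
are met by `f* = (Thr ∧ CLIQUE_k) ∨ Thr'`; thresholds are native). From the disproof side the only
structural lever is monotonicity-in-`δ` and the sandwich PolyHard(B₂) ⇒ crux ⇒ (MonotoneSuffices ⇒
PolyHard(B₂)); no finite/decidable instance exists (asymptotic statement), so no compute job was run.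
-/

set_option linter.dupNamespace false

namespace Summit.PneNP.PneNP.Cruxes.MonotoneBlind.Disproof

open Literature.Computability.Complexity Literature.Probability.RandomGraphs.PlantedClique Filter Finset
open Summit.PneNP.PneNP.Theses.KarlinRubin (MonotoneBlind)
open scoped ENNReal

/-- The error sum of a family `C` at clique exponent `1/2 - δ`. -/
noncomputable def errSum (δ : ℝ) (C : (n : ℕ) → Circuit ((⊤ : SimpleGraph (Fin n)).edgeSet)) (n : ℕ) :
    ℝ≥0∞ :=
  (erdosRenyiHalf n).toOuterMeasure {x | (C n).eval x = true} +
    (plantedCliqueDist n ⌈(n : ℝ) ^ (1 / 2 - δ)⌉₊).toOuterMeasure {x | (C n).eval x = false}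

/-- `DetectsMono δ c C`: the body of the crux's existential. -/
def DetectsMono (δ : ℝ) (c : ℕ) (C : (n : ℕ) → Circuit ((⊤ : SimpleGraph (Fin n)).edgeSet)) : Prop :=
  (∀ᶠ n : ℕ in atTop, (C n).IsOver monotoneBasis01 ∧ (C n).size ≤ n ^ c) ∧
    Tendsto (errSum δ C) atTop (nhds 0)

/-- The `δ`-instance of the crux. -/
def MonotoneBlindAt (δ : ℝ) : Prop := ∀ c : ℕ, ¬ ∃ C, DetectsMono δ c C

theorem monotoneBlind_iff : MonotoneBlind ↔ ∀ δ : ℝ, 0 < δ → δ < 1 / 2 → MonotoneBlindAt δ := Iff.rfl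

/-! ## §A Load-bearing analysis (all LANDED under `Theorems/MonotoneBlind/Negative/`) -/

/-- The crux with the hypothesis `0 < δ` deleted. -/
def MonotoneBlindWithoutPosDelta : Prop := ∀ δ : ℝ, δ < 1 / 2 → MonotoneBlindAt δ

/-- **`0 < δ` is load-bearing** (witness `δ = -1/2`: AND of all edges; `DeltaRange.lean`, p160741). -/
theorem without_posDelta_false : ¬ MonotoneBlindWithoutPosDelta :=
  Summit.PneNP.PneNP.Theorems.MonotoneBlind.Negative.monotoneBlind_false_without_posDelta

/-- The crux with the hypothesis `δ < 1/2` deleted. -/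
def MonotoneBlindWithoutUpperDelta : Prop := ∀ δ : ℝ, 0 < δ → MonotoneBlindAt δ

/-- **`δ < 1/2` is decoration** (`k ≤ 1` plants nothing; `DeltaRange.lean`, p160741). -/
theorem without_upperDelta_iff : MonotoneBlindWithoutUpperDelta ↔ MonotoneBlind :=
  Summit.PneNP.PneNP.Theorems.MonotoneBlind.Negative.monotoneBlind_iff_without_upperDelta

/-- At `δ ≥ 1/2` the instance holds outright (`errSum ≡ 1`). -/
theorem monotoneBlindAt_of_half_le {δ : ℝ} (hδ : 1 / 2 ≤ δ) : MonotoneBlindAt δ :=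
  Summit.PneNP.PneNP.Theorems.MonotoneBlind.Negative.monotoneBlindAt_of_half_le hδ

/-- The crux with the basis clause deleted (size bound kept). -/
def MonotoneBlindWithoutBasis : Prop :=
  ∀ δ : ℝ, 0 < δ → δ < 1 / 2 → ∀ c : ℕ,
    ¬ ∃ C : (n : ℕ) → Circuit ((⊤ : SimpleGraph (Fin n)).edgeSet),
      (∀ᶠ n : ℕ in atTop, (C n).size ≤ n ^ c) ∧ Tendsto (errSum δ C) atTop (nhds 0)

/-- **The basis clause is load-bearing** (one fan-in-`C(n,2)` gate, `c = 0`; `DeltaRange.lean`, p160741). -/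
theorem without_basis_false : ¬ MonotoneBlindWithoutBasis :=
  Summit.PneNP.PneNP.Theorems.MonotoneBlind.Negative.monotoneBlind_false_without_basis

/-- The crux with the size bound deleted. -/
def MonotoneBlindWithoutSizeBound : Prop :=
  ∀ δ : ℝ, 0 < δ → δ < 1 / 2 → ¬ ∃ C : (n : ℕ) → Circuit ((⊤ : SimpleGraph (Fin n)).edgeSet),
    (∀ᶠ n : ℕ in atTop, (C n).IsOver monotoneBasis01) ∧ Tendsto (errSum δ C) atTop (nhds 0)

/-- **The size bound is load-bearing** (brute force `CLIQUE(n, 3⌊log₂ n⌋+3)`; `LoadBearing.lean`). -/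
theorem without_sizeBound_false : ¬ MonotoneBlindWithoutSizeBound :=
  Summit.PneNP.PneNP.Theorems.MonotoneBlind.Negative.monotoneBlind_false_without_sizeBound

/-- The crux with the error clause deleted. -/
def MonotoneBlindWithoutErrorClause : Prop :=
  ∀ δ : ℝ, 0 < δ → δ < 1 / 2 → ∀ c : ℕ, ¬ ∃ C : (n : ℕ) → Circuit ((⊤ : SimpleGraph (Fin n)).edgeSet),
    ∀ᶠ n : ℕ in atTop, (C n).IsOver monotoneBasis01 ∧ (C n).size ≤ n ^ c

/-- **The error clause is load-bearing** (constant family; `LoadBearing.lean`). -/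
theorem without_errorClause_false : ¬ MonotoneBlindWithoutErrorClause :=
  Summit.PneNP.PneNP.Theorems.MonotoneBlind.Negative.monotoneBlind_false_without_errorClause

/-- The crux with `monotoneBasis01` weakened to `B₂` (= polynomial nonuniform planted-clique hardness). -/
def B2Blind : Prop :=
  ∀ δ : ℝ, 0 < δ → δ < 1 / 2 → ∀ c : ℕ, ¬ ∃ C : (n : ℕ) → Circuit ((⊤ : SimpleGraph (Fin n)).edgeSet),
    (∀ᶠ n : ℕ in atTop, (C n).IsOver B2 ∧ (C n).size ≤ n ^ c) ∧ Tendsto (errSum δ C) atTop (nhds 0)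

/-- **Dropping monotonicity STRENGTHENS the crux into the nonuniform PC conjecture** (landed
`karlinRubin_monotoneBlind_of_noPolyB2Detector`): no refutation can come from that mutation. -/
theorem monotoneBlind_of_B2Blind (h : B2Blind) : MonotoneBlind :=
  Summit.PneNP.PneNP.Theorems.karlinRubin_monotoneBlind_of_noPolyB2Detector h

/-! ## §B Tightness / boundary -/

/-- **Quasi-polynomial blindness is FALSE**: monotone size `n^{3⌊log₂ n⌋+5}` strongly detects at every
admissible `δ` (landed `exists_monotone_strongDetector`). The crux's room is poly vs `n^{O(log n)}`. -/
theorem not_quasipolyBlind (δ : ℝ) (hδ : 0 < δ) (hδ' : δ < 1 / 2) :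
    ∃ C : (n : ℕ) → Circuit ((⊤ : SimpleGraph (Fin n)).edgeSet),
      (∀ᶠ n : ℕ in atTop, (C n).IsOver monotoneBasis01 ∧ (C n).size ≤ n ^ (3 * Nat.log 2 n + 5)) ∧
        Tendsto (errSum δ C) atTop (nhds 0) := by
  obtain ⟨C, hB, hs, hT⟩ :=
    Summit.PneNP.PneNP.Theorems.MonotoneBlind.Negative.exists_monotone_strongDetector
      (ε := 1 / 2 - δ) (by linarith) (by linarith)
  exact ⟨C, hs.mono fun n hn => ⟨hB n, hn⟩, hT⟩

/-- Refuted for every `δ ≤ -1/2` (landed, `DeltaRange.lean`). -/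
theorem monotoneBlindAt_false_of_le_neg_half {δ : ℝ} (hδ : δ ≤ -1 / 2) : ¬ MonotoneBlindAt δ :=
  Summit.PneNP.PneNP.Theorems.MonotoneBlind.Negative.monotoneBlindAt_false_of_le_neg_half hδ

/-- **The crux's `δ`-instance is false for EVERY `δ < 0`** (LANDED `Negative/DegreeTest.lean`,
p162233): for `k = ⌈n^{1/2+|δ|}⌉` Kučera's max-degree test `[∃ v : #{absent slots at v} ≤ ⌊(2n-k)/4⌋]`
is a `{∧₂,∨₂,0,1}`-circuit of size `≤ n⁴` with error sum `≤ (n+1)·exp(-k²/(32n)) → 0`; for `δ < -1/4` by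
monotonicity in `δ`. So the hypothesis `0 < δ` is SHARP up to the boundary `δ = 0` (`k = ⌈√n⌉`), which
is open for strong monotone detection in polynomial size. [Kucera1995 §1] -/
theorem monotoneBlindAt_false_of_neg {δ : ℝ} (hδ : δ < 0) : ¬ MonotoneBlindAt δ :=
  Summit.PneNP.PneNP.Theorems.MonotoneBlind.Negative.monotoneBlindAt_false_of_neg hδ

/-- Packaged boundary statement: replacing the crux's range `(0, 1/2)` by `(δ₀, 1/2)` gives a FALSE
statement for every `δ₀ < 0` and an EQUIVALENT one for every upper end `≥ 1/2`. [folklore] -/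
theorem range_is_sharp_below {δ₀ : ℝ} (hδ₀ : δ₀ < 0) : ¬ ∀ δ : ℝ, δ₀ < δ → δ < 1 / 2 → MonotoneBlindAt δ :=
  Summit.PneNP.PneNP.Theorems.MonotoneBlind.Negative.monotoneBlind_false_on_any_larger_range hδ₀

/-! ## §C Natural strengthenings — see §B (`not_quasipolyBlind`) and the docblock. -/

/-! ## §D Targets: the registered skeleton's stubs (line `Sketch`, vertex-cover duality) -/

/-- **`stub_acceptanceSplit` is TRUE** (verbatim signature): acceptance and rejection masses of any
test under the planted law sum to `1`. Candidate proof for the lead. [folklore] -/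
theorem stub_acceptanceSplit_holds (n k : ℕ) (f : EdgeVec n → Bool) :
    (plantedCliqueDist n k).toOuterMeasure {y | f y = true} +
      (plantedCliqueDist n k).toOuterMeasure {y | f y = false} = 1 := by
  rw [PMF.toOuterMeasure_apply, PMF.toOuterMeasure_apply, ← ENNReal.tsum_add]
  have : (fun x : EdgeVec n => {y | f y = true}.indicator (plantedCliqueDist n k) x +
      {y | f y = false}.indicator (plantedCliqueDist n k) x) = plantedCliqueDist n k := by
    funext x
    cases h : f x <;> simp [Set.indicator, h]
  rw [this, PMF.tsum_coe]

/-- **Weak duality for covers (why `stub_coverCertificate` can exceed blindness).** If a family `U`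
of vertex sets supports weights `ν ≥ 0` whose up-shadows are dominated by the cover prices,
`∑_{A ∈ U, S ⊆ A} ν A ≤ w S` for every `S`, then every cover `G` of `U` (each `A ∈ U` contains some
`S ∈ G`) costs at least the total weight: `∑_{A∈U} ν A ≤ ∑_{S∈G} w S`. With `w S = (k'/n)^{|S|}` and
`ν` = (mass `m`) × (uniform measure on the transversals of `ℓ` disjoint `b`-blocks, `(k'/n)·b ≥ 1`)
this gives cover cost `≥ m` for the coupon-collector up-set although its `k'`-uniform measure tends
to `0` when `(k'/n)·b = ln ℓ - ω(1)` — the fixed-density cover formulation has no Park–Pham slack.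
[folklore] -/
theorem coverCost_ge_spreadMass {α : Type*} [DecidableEq α] (U : Finset (Finset α))
    (G : Finset (Finset α)) (ν : Finset α → ℝ≥0∞) (w : Finset α → ℝ≥0∞)
    (hcover : ∀ A ∈ U, ∃ S ∈ G, S ⊆ A)
    (hspread : ∀ S ∈ G, ∑ A ∈ U.filter (fun A => S ⊆ A), ν A ≤ w S) :
    ∑ A ∈ U, ν A ≤ ∑ S ∈ G, w S := by
  classical
  calc ∑ A ∈ U, ν A ≤ ∑ A ∈ U, ∑ S ∈ G.filter (fun S => S ⊆ A), ν A := by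
        refine sum_le_sum fun A hA => ?_
        obtain ⟨S, hS, hSA⟩ := hcover A hA
        have hmem : S ∈ G.filter (fun S => S ⊆ A) := mem_filter.2 ⟨hS, hSA⟩
        calc ν A = ∑ S ∈ ({S} : Finset (Finset α)), ν A := by simp
          _ ≤ ∑ S ∈ G.filter (fun S => S ⊆ A), ν A :=
            sum_le_sum_of_subset (singleton_subset_iff.2 hmem)
    _ = ∑ S ∈ G, ∑ A ∈ U.filter (fun A => S ⊆ A), ν A := by
        rw [sum_comm']
        intro A S
        simp only [mem_filter]
        tauto
    _ ≤ ∑ S ∈ G, w S := sum_le_sum hspread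

end Summit.PneNP.PneNP.Cruxes.MonotoneBlind.Disproof
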